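import Literature.Probability.Percolation.ArmExponentsTwoArm
import Literature.Probability.Percolation.TriRSWChaining
import HarnessLib

/-!
# Well-separated (fenced) two-arm events and Nolin's arm-separation theorem for `j = 2`

Topic: Probability / Percolation; family `crit-perc` (critical site percolation `P_{1/2}` on the
triangular lattice `𝕋 = triGraph`). Second bottom-up brick for the discharge of the named fact
`Literature.Probability.Percolation.Nolin2008_twoArm_quasiMult` (`ArmExponentsTwoArm.lean`; Nolin 2008, Prop. 17
[arXiv 0711.4948: Prop. 16], quasi-multiplicativity of the polychromatic two-arm probability
`b(r, R) = P_{1/2}(armEvent ![true, false] r R)`), hence of `Literature.Probability.Percolation.twoArm_exponent`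
(Smirnov–Werner 2001). Nolin deduces Prop. 17 from his **arm-separation theorem** (Thm. 11
[arXiv Thm. 10], after Kesten 1987) and RSW gluing of separated arms (Prop. 12 [arXiv Prop. 11]).
This file DEFINES the well-separated ("fenced", with Kesten's "free spaces") two-arm events in the
hexagonal annuli of `armEvent` and records the separation theorem, specialised to two arms, as a
named fact; the companion `ArmSeparationProofs.lean` PROVES the gluing and the implication
`Nolin2008_twoArm_separation → Nolin2008_twoArm_quasiMult`.

## Contents (namespace `Literature.StatMech` unless stated)

* Geometry on `∂Λ_N` (`Λ_N = triBall N`, the hexagon `{|·|_𝕋 ≤ N}`, `|·|_𝕋 = triNorm`; its right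
  side is `{x₀ = N, -N ≤ x₁ ≤ 0}` with corners `(N, 0)`, `(N, -N)`): the landing zone
  `sepLanding N` (middle half of the right side), the outer and inner free spaces
  `sepOuterFence N z = [N+1, N + N/8] × [t - N/64, t + N/64]` and
  `sepInnerFence n z = [n - n/8, n-1] × [t - n/64, t + n/64]` at a landing site `z = (·, t)`
  (Nolin 2008, §4.2, Def. 6 of the arXiv text, with `η = 1/64`: `√η M = M/8`, `η M = M/64`), the open hexagonal
  balls `triOpenBall z ρ`, the closed annulus `triAnnulusSet n N` (as a `Set`; the `Finset` is the
  tree's `triAnnulus`), and the bounding boxes `sepOuterZone N`, `sepInnerZone n` of the free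
  spaces and attaching balls off the annulus.
* `OpenVCrossThrough F lo hi ω u`: the box `F` is crossed vertically (from row `lo` to row `hi`)
  by open sites along a path through `u`; `sepJoinRegion n N z z'` (annulus plus the two
  attaching balls); the **fenced open arm landing on the right** `sepOpenArm n N` (Nolin's
  `Ã̃^{η,I/η',I'}` for one open arm, §4.2, relaxed to the open connection
  between the inner and the outer free space); the symmetry `negFlip ω = {x | -x ∉ ω}` (central
  symmetry composed with colour exchange) and the **well-separated two-arm event**
  `sepTwoArm n N = sepOpenArm n N ∩ negFlip ⁻¹' sepOpenArm n N` (open fenced arm landing on the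
  right sides, closed fenced arm landing on the left sides).
* The RSW gluing tubes between the outer free spaces at scale `m` and the inner free spaces at
  scale `n₂` (`8m ≤ n₂ ≤ 8m + 7`): `sepGridRow`, `sepGlueHeight`, `sepGlueEvent m n₂` (83
  box-crossing events: Nolin 2008, proof of Prop. 12 (ii); Kesten's extension through fences).
* `Literature.Probability.Percolation.Nolin2008_twoArm_separation` (named fact, Nolin 2008, Thm. 11 [arXiv Thm. 10]
  for `j = 2`, `σ = BW`, `p = 1/2`): `c · b(n, N) ≤ P_{1/2}(sepTwoArm n N)` for `n₀ ≤ n`,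
  `2n ≤ N`.

## Design choices and faithfulness

* Shapes. Nolin's annuli `S_{n,N}` are rhombi and his landing sequences live on the four sides
  of `∂S_N`; ours are the hexagons of `armEvent` (six sides), as everywhere in this library
  (`ArmExponentsTwoArm.lean`, faithfulness notes). Nolin (§4.2): "We first state the definition
  for a parallelogram ... and explain how to adapt it in other cases"; the separation proof (§4.4:
  U-shaped regions of the last dyadic annulus, Lemma 15 [arXiv Lemma 14], RSW) is local near the
  landing zone and insensitive to the shape.
* Scales. Nolin's Thm. 11 holds for every `η₀ ≤ η < 1` and all landing sequences of size `η`;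
  we fix `η = 1/64` (the largest power of `1/4` for which "middle half of a side" is a landing
  interval at distance `≥ 2√η N = N/4` from the corners) and the landing sequence "middle halves
  of the right sides (open arm) / of the left sides (closed arm)". Integer parts `N/4`, `N/8`,
  `N/64` discretise `2√η N`, `√η N`, `η N`.
* Free spaces. Nolin's `r_i = z_i + [0, √η M] × [-ηM, ηM]` contains the boundary column of the
  box it is attached to; our fence boxes exclude it (`[N+1, N+N/8]` outside, `[n-n/8, n-1]`
  inside), so that they lie off the annulus `{n ≤ |·|_𝕋 ≤ N}` — the form in which free spaces
  are used (Kesten's fences lie outside the square; gluing from outside must meet the fence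
  crossing). The attaching paths live in the open balls `S̊_{N/8}(z)`, `S̊_{n/8}(z')` as in
  Def. 6 of the arXiv text ("`c_i ↝ c̃_i` in `S̊_{√η M}(z_i)`").
* Relaxation. Of Nolin's arm `c_i`, its extremities `z_i ∈ I_i`, `z'_i ∈ I'_i` and its two
  attaching paths we only retain the existence of an open path from (a site of a vertical open
  crossing of) the inner free space to (a site of a vertical open crossing of) the outer free
  space inside `annulus ∪ S̊_{N/8}(z) ∪ S̊_{n/8}(z')`: every configuration of (the lattice
  rendering of) Nolin's event `Ã̃` lies in ours, so the lower bound of Thm. 11 transfers, and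
  this is all that gluing arguments use. Only the lower bound `≳` is recorded.
* For `j = 2` the two arms have different colours, so their disjointness is automatic and the
  two-arm event factors through `negFlip` (`sepTwoArm`); `negFlip` preserves `P_{1/2}`
  (`ArmSeparationProofs.lean`).
* Non-vacuity: the right half-plane configuration `{0 < x₀}` lies in `sepTwoArm n N` for all
  `16 ≤ n`, `2n ≤ N` (`halfPlane_mem_sepTwoArm`, `ArmSeparationProofs.lean`).

## References

* P. Nolin, *Near-critical percolation in two dimensions*, Electron. J. Probab. 13 (2008),
  1562–1623, §4.2 (well-separateness: free spaces, landing sequences, the events `Ã̃`), §4.3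
  (Thm. 11, Prop. 12, Lemma 13), §4.5 (Prop. 16–17); the arXiv text 0711.4948, which we read,
  numbers the results Thm. 10, Prop. 11, Lemma 12, Prop. 15–16 (EJP number = arXiv number + 1, as
  in `ArmExponentsTwoArm.lean`) and the definitions of §4.2 Def. 6–8 (cited here by section and
  arXiv number only). [Nolin2008]
* H. Kesten, *Scaling relations for 2D-percolation*, Comm. Math. Phys. 109 (1987), 109–156
  (fences and well-separated arms; cited after Nolin 2008, §4.2, "similar to Kesten's fences",
  and Smirnov–Werner 2001, §4.2; not held in the literature store). [Kesten1987]
* S. Smirnov, W. Werner, *Critical exponents for two-dimensional percolation*, Math. Res. Lett. 8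
  (2001), §4 (10), §4.2. [SmirnovWernerMRL2001]

Mathlib search: Mathlib has no percolation, arm events or RSW theory (`rg -i "percolation|arm
event|Russo-Seymour"` in Mathlib: nothing relevant); used from Mathlib: `Set`/`Finset` API,
`Equiv.neg`, `Matrix.vecCons` notation. Tree: `triNorm`, `triBall`, `triSphere`
(`TriangularLattice.lean`), `PathIn` (`SitePaths.lean`), `triStrip`, `triHCross`, `triVCross`
(`TriRSWChaining.lean`), `armEvent`, `polyArmProb` (`ArmEvents.lean`), `triAnnulus`
(`ArmEventsProofs.lean`), `critTwoArmProb`, `Nolin2008_twoArm_quasiMult`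
(`ArmExponentsTwoArm.lean`), `DeterminedBy` (`PercolationEvents.lean`).
-/

noncomputable section

open MeasureTheory Set

namespace Literature.Probability.Percolation

/-! ### Geometry: landing zones, fences, hexagonal balls -/

/-- The **landing zone** on the right side of the hexagon `∂Λ_N` (`Λ_N = triBall N`): the sites
`z = (N, t)` of `∂Λ_N` with `N/4 ≤ -t ≤ N - N/4` (integer parts), i.e. the middle half of the
side `{x₀ = N, -N ≤ x₁ ≤ 0}`, at distance `≥ N/4 = 2√η N` (`η = 1/64`) from the two corners
`(N, 0)`, `(N, -N)` of that side (Nolin 2008, §4.2, Def. 8 of arXiv 0711.4948: a landing interval `I` with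
`dist(I, Z_±) ≥ 2√η N` and `length(I) ≥ η N`; here `length = N/2`). [cite: Nolin2008, §4.2, landing sequences (arXiv 0711.4948: Def. 8)] -/
def sepLanding (N : ℕ) : Set (LatticeModels.Site 2) :=
  {z | z 0 = N ∧ ((N / 4 : ℕ) : ℤ) ≤ -z 1 ∧ -z 1 ≤ (N : ℤ) - (N / 4 : ℕ)}

/-- Membership in the landing zone, unfolded. [cite: Nolin2008, §4.2, landing sequences (arXiv 0711.4948: Def. 8)] -/
@[simp] theorem mem_sepLanding {N : ℕ} {z : LatticeModels.Site 2} :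
    z ∈ sepLanding N ↔ z 0 = N ∧ ((N / 4 : ℕ) : ℤ) ≤ -z 1 ∧ -z 1 ≤ (N : ℤ) - (N / 4 : ℕ) :=
  Iff.rfl

/-- The **outer free space (fence box)** at the landing site `z = (N, t)` of `∂Λ_N`: the lattice
parallelogram `[N+1, N + N/8] × [t - N/64, t + N/64]` attached to `Λ_N` outside its right side
(Nolin 2008, §4.2, Def. 6 of arXiv 0711.4948: `r_i = z_i + [0, √η M] × [-η M, η M]` with `η = 1/64`, `√η = 1/8`; here
the column `x₀ = N` of `∂Λ_N` itself is excluded, so that the box lies outside `Λ_N`). [cite: Nolin2008, §4.2, free spaces (arXiv 0711.4948: Def. 6)] -/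
def sepOuterFence (N : ℕ) (z : LatticeModels.Site 2) : Set (LatticeModels.Site 2) :=
  {v | (N : ℤ) + 1 ≤ v 0 ∧ v 0 ≤ (N : ℤ) + (N / 8 : ℕ) ∧
    z 1 - (N / 64 : ℕ) ≤ v 1 ∧ v 1 ≤ z 1 + (N / 64 : ℕ)}

/-- Membership in the outer fence box, unfolded. [cite: Nolin2008, §4.2, free spaces (arXiv 0711.4948: Def. 6)] -/
@[simp] theorem mem_sepOuterFence {N : ℕ} {z v : LatticeModels.Site 2} :
    v ∈ sepOuterFence N z ↔ (N : ℤ) + 1 ≤ v 0 ∧ v 0 ≤ (N : ℤ) + (N / 8 : ℕ) ∧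
      z 1 - (N / 64 : ℕ) ≤ v 1 ∧ v 1 ≤ z 1 + (N / 64 : ℕ) :=
  Iff.rfl

/-- The **inner free space (fence box)** at the landing site `z = (n, t)` of `∂Λ_n`, attached to
`∂Λ_n` inside: the parallelogram `[n - n/8, n - 1] × [t - n/64, t + n/64]` (Nolin 2008, §4.2, Def. 6 of
arXiv 0711.4948 and the paragraph after its Def. 7: "We take the same definition for the internal boundary `∂S_n`:
... the free spaces are included in `S_n`"; here the column `x₀ = n` of `∂Λ_n` itself is
excluded, so that the box lies in the interior `Λ̊_n`). [cite: Nolin2008, §4.2, free spaces on the internal boundary (arXiv 0711.4948: Def. 6–7)] -/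
def sepInnerFence (n : ℕ) (z : LatticeModels.Site 2) : Set (LatticeModels.Site 2) :=
  {v | (n : ℤ) - (n / 8 : ℕ) ≤ v 0 ∧ v 0 ≤ (n : ℤ) - 1 ∧
    z 1 - (n / 64 : ℕ) ≤ v 1 ∧ v 1 ≤ z 1 + (n / 64 : ℕ)}

/-- Membership in the inner fence box, unfolded. [cite: Nolin2008, §4.2, free spaces on the internal boundary (arXiv 0711.4948: Def. 6–7)] -/
@[simp] theorem mem_sepInnerFence {n : ℕ} {z v : LatticeModels.Site 2} :
    v ∈ sepInnerFence n z ↔ (n : ℤ) - (n / 8 : ℕ) ≤ v 0 ∧ v 0 ≤ (n : ℤ) - 1 ∧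
      z 1 - (n / 64 : ℕ) ≤ v 1 ∧ v 1 ≤ z 1 + (n / 64 : ℕ) :=
  Iff.rfl

/-- The open hexagonal ball `S̊_ρ(z) = {v : |v - z|_𝕋 < ρ}` of `𝕋` (`|·|_𝕋 = triNorm`), the
region in which an arm is required to be joined to its free space (Nolin 2008, §4.2, Def. 6 of
arXiv 0711.4948: "`c_i ↝ c̃_i` in `S̊_{√η M}(z_i)`"). [cite: Nolin2008, §4.2, free spaces (arXiv 0711.4948: Def. 6)] -/
def triOpenBall (z : LatticeModels.Site 2) (ρ : ℕ) : Set (LatticeModels.Site 2) := {v | LatticeModels.triNorm (v - z) < ρ}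

/-- Membership in the open hexagonal ball, unfolded. [cite: Nolin2008, §4.2, free spaces (arXiv 0711.4948: Def. 6)] -/
@[simp] theorem mem_triOpenBall {z v : LatticeModels.Site 2} {ρ : ℕ} :
    v ∈ triOpenBall z ρ ↔ LatticeModels.triNorm (v - z) < ρ := Iff.rfl

/-- The closed hexagonal annulus `{v : n ≤ |v|_𝕋 ≤ N} = (Λ_N \ Λ_n) ∪ ∂Λ_n` as a set of sites
(the set underlying `triAnnulus n N`), the region of the arms of `armEvent κ n N`. [cite: SmirnovWernerMRL2001, §3] -/
def triAnnulusSet (n N : ℕ) : Set (LatticeModels.Site 2) := {v | (n : ℤ) ≤ LatticeModels.triNorm v ∧ LatticeModels.triNorm v ≤ N}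

/-- Membership in the closed annulus, unfolded. [cite: SmirnovWernerMRL2001, §3] -/
@[simp] theorem mem_triAnnulusSet {n N : ℕ} {v : LatticeModels.Site 2} :
    v ∈ triAnnulusSet n N ↔ (n : ℤ) ≤ LatticeModels.triNorm v ∧ LatticeModels.triNorm v ≤ N := Iff.rfl

/-- `triAnnulusSet n N` is the set of sites of the `Finset` `triAnnulus n N`. [cite: SmirnovWernerMRL2001, §3] -/
theorem coe_triAnnulus (n N : ℕ) : (↑(triAnnulus n N) : Set (LatticeModels.Site 2)) = triAnnulusSet n N := by
  ext v; simp

/-! ### Fenced (well-separated) arms -/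

/-- **A free space crossed through `u`.** The box `F` (one of the fence boxes, with bottom row
`x₁ = lo` and top row `x₁ = hi`) is crossed vertically by open sites of `ω` along a path passing
through the site `u`: there are open `𝕋`-paths inside `F` from the bottom row to `u` and from `u`
to the top row (Nolin 2008, §4.2, Def. 6 of arXiv 0711.4948: "each `r_i` is crossed vertically
by some crossing `c̃_i`";
`u` is the site of `c̃_i` at which the arm is attached). [cite: Nolin2008, §4.2, free spaces (arXiv 0711.4948: Def. 6)] -/
def OpenVCrossThrough (F : Set (LatticeModels.Site 2)) (lo hi : ℤ) (ω : SiteConfig (LatticeModels.Site 2)) (u : LatticeModels.Site 2) :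
    Prop :=
  ∃ b t : LatticeModels.Site 2, b 1 = lo ∧ t 1 = hi ∧ PathIn LatticeModels.triGraph (F ∩ ω) b u ∧ PathIn LatticeModels.triGraph (F ∩ ω) u t

/-- The region allowed to the arm and to its two attaching paths: the closed annulus
`{n ≤ |·|_𝕋 ≤ N}` together with the open balls `S̊_{N/8}(z)` and `S̊_{n/8}(z')` around the outer
and inner landing sites (Nolin 2008, §4.2, Def. 6–7 of arXiv 0711.4948: the arm lies in
`S_{n,N}`, the attaching paths in `S̊_{√η N}(z)`, `S̊_{√η n}(z')`). [cite: Nolin2008, §4.2, free spaces on the internal boundary (arXiv 0711.4948: Def. 6–7)] -/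
def sepJoinRegion (n N : ℕ) (z z' : LatticeModels.Site 2) : Set (LatticeModels.Site 2) :=
  triAnnulusSet n N ∪ triOpenBall z (N / 8) ∪ triOpenBall z' (n / 8)

/-- **The fenced open arm, landing on the right** (`j = 1` instance of Nolin's
`Ã̃^{η,I/η',I'}_{j,σ}(n, N)`, §4.2, Def. 6–8 of arXiv 0711.4948, `σ = B`, `η = η' = 1/64`, `I`, `I'` the
middle halves of the right sides of `∂Λ_n`, `∂Λ_N`, in the hexagonal annuli of `armEvent`):
there are landing sites `z ∈ sepLanding N`, `z' ∈ sepLanding n`, an outer free space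
`sepOuterFence N z` crossed vertically by open sites through a site `u'`, an inner free space
`sepInnerFence n z'` crossed vertically by open sites through a site `u`, and an open `𝕋`-path
from `u` to `u'` inside `sepJoinRegion n N z z'` (the annulus plus the two attaching balls).
Only the open connection between the two free spaces is retained from Nolin's arm `c_i` and its
attaching paths `c_i ↝ c̃_i` (a relaxation: Nolin's event is contained in this one), which is
all that the gluing constructions use. [cite: Nolin2008, §4.2, well-separated arm events (arXiv 0711.4948: Def. 6–8)] -/
def sepOpenArm (n N : ℕ) : Set (SiteConfig (LatticeModels.Site 2)) :=
  {ω | ∃ z z' u u' : LatticeModels.Site 2, z ∈ sepLanding N ∧ z' ∈ sepLanding n ∧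
    OpenVCrossThrough (sepInnerFence n z') (z' 1 - (n / 64 : ℕ)) (z' 1 + (n / 64 : ℕ)) ω u ∧
    OpenVCrossThrough (sepOuterFence N z) (z 1 - (N / 64 : ℕ)) (z 1 + (N / 64 : ℕ)) ω u' ∧
    PathIn LatticeModels.triGraph (sepJoinRegion n N z z' ∩ ω) u u'}

/-- **Central symmetry composed with colour exchange**: `negFlip ω = {x | -x ∉ ω}`, the
configuration whose open sites are the images under `x ↦ -x` of the closed sites of `ω`. It
exchanges "open arm landing on the right side" with "closed arm landing on the left side"; at
`p = 1/2` it preserves `P_p` (Smirnov–Werner 2001, Rem. 2, colour exchange; lattice symmetry). [cite: SmirnovWernerMRL2001, Rem. 2] -/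
def negFlip (ω : SiteConfig (LatticeModels.Site 2)) : SiteConfig (LatticeModels.Site 2) := {x | -x ∉ ω}

/-- Membership in `negFlip ω`. [cite: SmirnovWernerMRL2001, Rem. 2] -/
@[simp] theorem mem_negFlip {ω : SiteConfig (LatticeModels.Site 2)} {x : LatticeModels.Site 2} : x ∈ negFlip ω ↔ -x ∉ ω :=
  Iff.rfl

/-- `negFlip` is an involution. [cite: SmirnovWernerMRL2001, Rem. 2] -/
@[simp] theorem negFlip_negFlip (ω : SiteConfig (LatticeModels.Site 2)) : negFlip (negFlip ω) = ω := by
  ext x; simp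

/-- **The well-separated two-arm event** (Nolin 2008, §4.2, the event
`Ã̃^{η,I/η',I'}_{2,BW}(n, N)`, with `η = η' = 1/64` and the landing sequences `I = (I_B, I_W)`, `I' = (I'_B, I'_W)` given
by the middle halves of the right sides (for the open = black arm) and of the left sides (for the
closed = white arm) of `∂Λ_n`, `∂Λ_N`; relaxed as in `sepOpenArm`): a fenced open arm landing on
the right (`sepOpenArm n N`) and a fenced closed arm landing on the left, the latter written as
`negFlip ω ∈ sepOpenArm n N`. The two arms are disjoint, being of different colours. [cite: Nolin2008, §4.2, well-separated arm events with landing areas (arXiv 0711.4948: Def. 6–8)] -/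
def sepTwoArm (n N : ℕ) : Set (SiteConfig (LatticeModels.Site 2)) := sepOpenArm n N ∩ negFlip ⁻¹' sepOpenArm n N

/-- The bounding box `[N+1, N + N/8] × [-N, 0]` of the outer free spaces and of the outer
attaching balls (outside `Λ_N`) at the landing sites of `sepLanding N`: the set of sites off the
annulus on which `sepOpenArm n N` may depend near `∂Λ_N`. [cite: Nolin2008, §4.2, free spaces (arXiv 0711.4948: Def. 6)] -/
def sepOuterZone (N : ℕ) : Set (LatticeModels.Site 2) :=
  {v | (N : ℤ) + 1 ≤ v 0 ∧ v 0 ≤ (N : ℤ) + (N / 8 : ℕ) ∧ -(N : ℤ) ≤ v 1 ∧ v 1 ≤ 0}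

/-- Membership in `sepOuterZone`, unfolded. [cite: Nolin2008, §4.2, free spaces (arXiv 0711.4948: Def. 6)] -/
@[simp] theorem mem_sepOuterZone {N : ℕ} {v : LatticeModels.Site 2} :
    v ∈ sepOuterZone N ↔ (N : ℤ) + 1 ≤ v 0 ∧ v 0 ≤ (N : ℤ) + (N / 8 : ℕ) ∧ -(N : ℤ) ≤ v 1 ∧ v 1 ≤ 0 :=
  Iff.rfl

/-- The bounding box `[n - n/8, n - 1] × [-(n-1), 0]` of the inner free spaces and of the inner
attaching balls (inside `Λ̊_n`) at the landing sites of `sepLanding n`. [cite: Nolin2008, §4.2, free spaces on the internal boundary (arXiv 0711.4948: Def. 6–7)] -/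
def sepInnerZone (n : ℕ) : Set (LatticeModels.Site 2) :=
  {v | (n : ℤ) - (n / 8 : ℕ) ≤ v 0 ∧ v 0 ≤ (n : ℤ) - 1 ∧ -((n : ℤ) - 1) ≤ v 1 ∧ v 1 ≤ 0}

/-- Membership in `sepInnerZone`, unfolded. [cite: Nolin2008, §4.2, free spaces on the internal boundary (arXiv 0711.4948: Def. 6–7)] -/
@[simp] theorem mem_sepInnerZone {n : ℕ} {v : LatticeModels.Site 2} :
    v ∈ sepInnerZone n ↔ (n : ℤ) - (n / 8 : ℕ) ≤ v 0 ∧ v 0 ≤ (n : ℤ) - 1 ∧ -((n : ℤ) - 1) ≤ v 1 ∧ v 1 ≤ 0 :=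
  Iff.rfl

/-! ### The gluing tubes between an outer free space at scale `m` and an inner one at scale `n₂` -/

/-- The rows `y_k = -(N - N/4) - N/64 + k · (N/64)` (`k < 40`) of a grid of step `N/64` covering
the rows met by the free spaces at the landing sites of `sepLanding N`: every fence box
`[·] × [t - N/64, t + N/64]`, `(N, t) ∈ sepLanding N`, contains a full grid slab
`[·] × [y_k, y_k + N/64]` (for `N ≥ 370`). (The finitely many "small boxes" of an RSW gluing
construction, Nolin 2008, proof of Prop. 12 (ii) [arXiv Prop. 11]; Kesten 1987, extension of arms
through fences.) [cite: Nolin2008, §4.3 Prop. 12 (proof) (arXiv 0711.4948: Prop. 11)] -/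
def sepGridRow (N k : ℕ) : ℤ := -((N : ℤ) - (N / 4 : ℕ)) - (N / 64 : ℕ) + k * (N / 64 : ℕ)

/-- The common height `L = n₂ - n₂/4 + n₂/64` of the three long gluing tubes (they occupy the rows
`[-L, 0]`). [cite: Nolin2008, §4.3 Prop. 12 (proof) (arXiv 0711.4948: Prop. 11)] -/
def sepGlueHeight (n₂ : ℕ) : ℕ := n₂ - n₂ / 4 + n₂ / 64

/-- **The gluing event** between the outer free spaces at scale `m` (right side of `Λ_m`) and the
inner free spaces at scale `n₂` (inside the right side of `Λ_{n₂}`), `8 m ≤ n₂ ≤ 8 m + 7`: with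
`A = m/8`, `B = m/64`, `A' = n₂/8`, `B' = n₂/64`, `L = sepGlueHeight n₂`, open horizontal
crossings of the 40 boxes `[m+1, m+2A] × [y_k, y_k + B]` (`y_k = sepGridRow m k`) and of the 40
boxes `[n₂ - 2A', n₂ - 1] × [y'_k, y'_k + B']` (`y'_k = sepGridRow n₂ k`), open vertical crossings
of `[m+A+1, m+2A] × [-L, 0]` and `[n₂ - 2A', n₂ - A' - 1] × [-L, 0]`, and an open horizontal
crossing of `[m+A+1, n₂ - A' - 1] × [-L, 0]`. On this event every vertical open crossing of an
outer fence box at scale `m` is joined by open sites of `{m < |·|_𝕋 < n₂, x₀ > 0}` to every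
vertical open crossing of an inner fence box at scale `n₂` (RSW gluing through free spaces:
Nolin 2008, proof of Prop. 12 (ii) [arXiv Prop. 11], "once well-separated, the arms can easily
be extended"; Kesten 1987, fences). [cite: Nolin2008, §4.3 Prop. 12 (proof) (arXiv 0711.4948: Prop. 11)] -/
def sepGlueEvent (m n₂ : ℕ) : Set (SiteConfig (LatticeModels.Site 2)) :=
  (⋂ k ∈ Finset.range 40,
      Literature.Probability.Percolation.triHCross ((m : ℤ) + 1) (sepGridRow m k) (2 * (m / 8) - 1) (m / 64)) ∩
    Literature.Probability.Percolation.triVCross ((m : ℤ) + (m / 8 : ℕ) + 1) (-(sepGlueHeight n₂ : ℤ)) (m / 8 - 1)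
      (sepGlueHeight n₂) ∩
    Literature.Probability.Percolation.triHCross ((m : ℤ) + (m / 8 : ℕ) + 1) (-(sepGlueHeight n₂ : ℤ))
      (n₂ - n₂ / 8 - 1 - (m + m / 8 + 1)) (sepGlueHeight n₂) ∩
    Literature.Probability.Percolation.triVCross ((n₂ : ℤ) - (2 * (n₂ / 8) : ℕ)) (-(sepGlueHeight n₂ : ℤ)) (n₂ / 8 - 1)
      (sepGlueHeight n₂) ∩
    (⋂ k ∈ Finset.range 40,
      Literature.Probability.Percolation.triHCross ((n₂ : ℤ) - (2 * (n₂ / 8) : ℕ)) (sepGridRow n₂ k) (2 * (n₂ / 8) - 1)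
        (n₂ / 64))

end Literature.Probability.Percolation

namespace Literature.Probability.Percolation

open LatticeModels

/-- **Arm separation for two arms** (Nolin 2008, Thm. 11 [arXiv 0711.4948: Thm. 10]: "Fix an
integer `j ≥ 1`, some color sequence `σ` and `η₀, η'₀ ∈ (0,1)`. Then
`P̂(Ã̃^{η,I/η',I'}_{j,σ}(n, N)) ≍ P̂(A_{j,σ}(n, N))` uniformly in all landing sequences `I/I'`
of size `η/η'`, with `η ≥ η₀` and `η' ≥ η'₀`, `p`, `P̂` between `P_p` and `P_{1-p}`,
`n ≤ N ≤ L(p)`"; after Kesten 1987), specialised to `j = 2`, `σ = BW`, `p = 1/2`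
(where `L(1/2) = ∞`), `η = η' = 1/64`, the landing sequences "middle half of the right side /
middle half of the left side" of the hexagons `∂Λ_n`, `∂Λ_N`, and the relaxed fenced event
`sepTwoArm n N ⊇ Ã̃` (so that only the lower bound `≳` is recorded, the upper bound being
trivial for Nolin's event and not claimed for the relaxed one). In Lean: there are `c > 0` and a
threshold `n₀` with `c · P_{1/2}(armEvent ![true, false] n N) ≤ P_{1/2}(sepTwoArm n N)` for all
`n₀ ≤ n`, `2 n ≤ N`. Nolin's annuli are rhombi `S_N ∖ S̊_n` and ours the hexagons of
`armEvent`; the proof (Nolin §4.4, separation in the U-shaped regions of the last annulus on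
each dyadic scale, Lemma 15 [arXiv Lemma 14], plus RSW extensions) is insensitive to this, and
the restriction `2n ≤ N` is that of its first reduction step ("it suffices to prove the result
for `n`, `N` which are powers of two"). This is the deep input of quasi-multiplicativity
(Nolin Prop. 17 [arXiv Prop. 16]) and stays a named fact. [cite: Nolin2008, Thm. 11 (arXiv 0711.4948: Thm. 10)] -/
def Nolin2008_twoArm_separation : Prop :=
  ∃ c : ℝ, 0 < c ∧ ∃ n₀ : ℕ, ∀ n N : ℕ, n₀ ≤ n → 2 * n ≤ N →
    c * critTwoArmProb n N ≤ (triSitePercolation half).real (sepTwoArm n N)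

end Literature.Probability.Percolation

end
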